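import Literature.IUT.HodgeTheaters.PuncturedEllipticProLModelFrattini
import Literature.IUT.HodgeTheaters.PuncturedEllipticProLModelLines
import HarnessLib

/-!
# An infinite pro-`l` model of [IUTchI] §1, part 14: (L2a) and (L2c) at a GENUINE datum, read off the shadow

Mochizuki, *Inter-universal Teichmüller theory I*, kurims manuscript (May 2020), §1 p. 37 l. 30–36: "`Δ_X̲ ↠ Δ_X̲^{ab} ⊗
(ℤ/lℤ) ↠ Δ_ε` … we obtain a natural exact sequence `0 → I_ε′ × I_ε″ → Δ_ε → Δ_E ⊗ (ℤ/lℤ) → 0` … noncanonical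
isomorphisms `I_ε′ ≅ ℤ/lℤ ≅ I_ε″`" ([IUTchI] §1 p.37) [claim: Mochizuki2012, status: disputed] — abc-iut-L5-t1's typed
fields (L2a) `ModLCuspLaws.inertia_ε1_image_order` and (L2c) `ModLCuspLaws.inertia_images_inf_le` (p446054), the LAW
binders `hL2a hL2c hL2a′ hL2c′` of the current [IUTchI] Cor. 1.2 closers (abc-iut-w6-d032 p496734, abc-iut-f-090).
Classical inputs: [AbsTopI] Lemma 4.5 (i) p. 54 [cite: MochizukiAbsTopI2012, Lemma 4.5 (i) p.54].  (D-0012 claim key;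
series status DISPUTED — PROOF-ONLY module; nothing of the series is asserted, no side is taken on [IUTchIII] Cor. 3.12.)

Cell abc-iut, seat abc-iut-L5-d4 (gen 12), row R45 «COR12-MODL-LAWS-DERIVE@M_l» (abc-iut-L5-lead RULINGS #118 (2)(a)):
**(L2a) and (L2c) DERIVED at a genuine datum `D′`** from abc-iut-L5-t1's origin record `GeomOrigin` (A) (c′), a cusp
action `CuspGalois`, `[Π_X : Π_X̲] = l` prime, and ONE classical law
  (I) «distinct cusps of `X̲` have non-`Π_X̲`-conjugate INERTIA groups» (`hI`, the inertia twin of `CuspGalois.eq_of_conj`;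
  [CombGC] Prop. 1.2 (i)-type cuspidal-edge separation; NEEDED: the interface does not exclude two cusps sharing one
  inertia group, and then (L2a) fails),
through the `Δ_X̲`-abelian shadow `F : Δ_X′ → P` of parts 9–13: `F(I′_x) = D_{κ x}` with `κ` INJECTIVE (by (I)),
`F(Ker′) = Ker`, `F⁻¹(Ker) ∩ Δ_X̲′ = Ker′`, so the printed sentences are the general-position line facts of part 12:
* `conj_smul_topologicalClosure_zpowers`, `eq_of_label_eq` — conjugate cyclic closures; label injectivity from (I);
* `subgroupOf_sup_of_le`, `subgroupOf_iSup_of_le`, `map_deltaEpsKer_eq` — `F(Ker(Δ_X̲′ ↠ Δ_ε)) = Ker · ∏_{x ≠ ε⁰,ε′,ε″} D_{κ x}`;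
* **`inertia_images_inf_le_of_shadow`** (L2c), **`inertia_ε1_image_order_of_shadow`** (L2a) for a standard shadow;
* **`GeomOrigin.inertia_images_inf_le`**, **`GeomOrigin.inertia_ε1_image_order`** — the two printed sentences at `D′`
  from `(O, C, l prime, hX, hI)` alone (standard basis: `PuncturedEllipticGeomOriginStandardBasis`; shadow: part 9);
* `inertia_conj_injective_datum` — NV: (I) HOLDS at the pro-`l` datum (jointly with parts 3–8's `CuspGalois`, `ModLCuspLaws`, …).
HONEST LABEL: a DERIVATION over OUR interfaces — the binders `hL2a hL2c` become theorems GIVEN (A) (c′) + `CuspGalois` +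
`[Π_X : Π_X̲] = l` + (I); (I) is an assumption-shaped classical input, asserted for no instance; no `sorry`.
-/

noncomputable section

namespace Literature.IUT.HodgeTheaters

namespace PuncturedEllipticData

universe u

namespace ProLModel

open DihedralGroup _root_.Topology Literature.AnabelianGeometry.AbsoluteAnabelian
open scoped Pointwise

variable (l : ℕ) [Fact l.Prime]

/-- Part 12's general-position (L2c) with one more explicit line: `D_{k₁} ∩ (D_{k₂} · Ker · ∏_i D_{κ i}) ⊆ Ker` when
`k₁, k₂, m` are pairwise distinct and `κ` misses `k₁` and `m`. ([IUTchI] §1 p.37) [claim: Mochizuki2012, status: disputed] -/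
theorem line_inf_line_sup_le_modLKer (h5 : 5 ≤ l) {ι : Type*} (κ : ι → ZMod l) {k₁ k₂ m : ZMod l} (h1m : k₁ ≠ m)
    (h21 : k₂ ≠ k₁) (h2m : k₂ ≠ m) (hk : ∀ i, κ i ≠ k₁) (hm : ∀ i, κ i ≠ m) :
    Dm l k₁ ⊓ (Dm l k₂ ⊔ ((datum l h5).modLKer ⊔ ⨆ i, Dm l (κ i))) ≤ (datum l h5).modLKer := by
  have h := line_inf_sup_le_modLKer l h5 (fun o : Option ι => o.elim k₂ κ) h1m
    (by rintro (_ | i); exacts [h21, hk i]) (by rintro (_ | i); exacts [h2m, hm i])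
  rw [iSup_option] at h
  simp only [Option.elim_none, Option.elim_some] at h
  rwa [sup_left_comm] at h

/-! ### Generic: conjugating cyclic closures; joins inside a subgroup -/

omit [Fact l.Prime] in
/-- `h ⟨u⟩⁻ h⁻¹ = ⟨h u h⁻¹⟩⁻`. [claim: Mochizuki2012, status: disputed] -/
theorem conj_smul_topologicalClosure_zpowers {G : Type*} [Group G] [TopologicalSpace G] [IsTopologicalGroup G]
    (h u : G) : MulAut.conj h • (Subgroup.zpowers u).topologicalClosure =
      (Subgroup.zpowers (h * u * h⁻¹)).topologicalClosure := by
  ext x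
  rw [Subgroup.mem_pointwise_smul_iff_inv_smul_mem, MulAut.smul_def, ← map_inv, MulAut.conj_apply, inv_inv]
  constructor
  · intro hx
    have h' := conj_mem_topologicalClosure_zpowers h u hx
    rwa [show h * (h⁻¹ * x * h) * h⁻¹ = x by group] at h'
  · intro hx
    have h' := conj_mem_topologicalClosure_zpowers h⁻¹ (h * u * h⁻¹) hx
    rwa [show h⁻¹ * (h * u * h⁻¹) * h⁻¹⁻¹ = u by group, inv_inv] at h'

omit [Fact l.Prime] in
/-- `(A ⊔ B) ∩ K = (A ∩ K) ⊔ (B ∩ K)` inside `K` for `A, B ⊆ K`. [claim: Mochizuki2012, status: disputed] -/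
theorem subgroupOf_sup_of_le {G : Type*} [Group G] {K A B : Subgroup G} (hA : A ≤ K) (hB : B ≤ K) :
    (A ⊔ B).subgroupOf K = A.subgroupOf K ⊔ B.subgroupOf K := by
  apply Subgroup.map_injective K.subtype_injective
  rw [Subgroup.map_sup, Subgroup.subgroupOf_map_subtype, Subgroup.subgroupOf_map_subtype,
    Subgroup.subgroupOf_map_subtype, inf_eq_left.mpr hA, inf_eq_left.mpr hB, inf_eq_left.mpr (sup_le hA hB)]

omit [Fact l.Prime] in
/-- `(⨆ A_i) ∩ K = ⨆ (A_i ∩ K)` inside `K` for `A_i ⊆ K`. [claim: Mochizuki2012, status: disputed] -/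
theorem subgroupOf_iSup_of_le {G : Type*} [Group G] {ι : Sort*} {K : Subgroup G} {A : ι → Subgroup G}
    (hA : ∀ i, A i ≤ K) : (⨆ i, A i).subgroupOf K = ⨆ i, (A i).subgroupOf K := by
  apply Subgroup.map_injective K.subtype_injective
  rw [Subgroup.map_iSup, Subgroup.subgroupOf_map_subtype, inf_eq_left.mpr (iSup_le hA)]
  simp_rw [Subgroup.subgroupOf_map_subtype]
  exact iSup_congr fun i => (inf_eq_left.mpr (hA i)).symm

variable {D' : PuncturedEllipticData.{u}} {gens : Fin 2 → ↥(D'.PiX ⊓ D'.DeltaC)}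
  (hfree : IsFreeProOn ↥(D'.PiX ⊓ D'.DeltaC) Set.univ gens) (F : ↥(D'.PiX ⊓ D'.DeltaC) →* P l)
  (hF : Continuous F) (h0 : F (gens 0) = elA l 1) (h1 : F (gens 1) = inN l (δ l 0))
  (hb : (gens 1 : D'.PiC) ∈ D'.PiCbar) (C : D'.CuspGalois) (hX : D'.PiXbar.relIndex D'.PiX = D'.l)

/-! ### Labels: `F(I′_x) = D_{κ x}` with `κ` injective -/

include hfree hF h0 h1 in
/-- The `a`-exponent mod `l` of `F g` vanishes iff `F g ∈ Π_X̲`. [claim: Mochizuki2012, status: disputed] -/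
theorem toZMod_right_left_eq_zero_iff (g : ↥(D'.PiX ⊓ D'.DeltaC)) :
    PadicInt.toZMod (Multiplicative.toAdd (F g).right.left) = 0 ↔ F g ∈ PiXm l ⊓ PiCbarm l := by
  rw [mem_PiXbar_iff]
  exact ⟨fun h => ⟨(mem_PiXm_iff l _).1 (shadow_mem_PiXm l hfree F hF h0 h1 g), h⟩, fun h => h.2⟩

include hfree hF h0 h1 in
/-- The label `(F g)·0 ∈ ℤ/l` of `g ∈ Δ_X′` is the `a`-exponent of `F g` mod `l`. [claim: Mochizuki2012, status: disputed] -/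
theorem cuspAct_toDih_zero (g : ↥(D'.PiX ⊓ D'.DeltaC)) :
    ArrowModel.cuspAct l (toDih l (F g).right) 0 = PadicInt.toZMod (Multiplicative.toAdd (F g).right.left) := by
  rw [toDih_right_of_mem_PiXm l (shadow_mem_PiXm l hfree F hF h0 h1 g), ArrowModel.cuspAct_r, zero_add]

include hfree hF h0 h1 hb C hX in
/-- **Equal labels ⇒ `Δ_X̲′`-related conjugators**: if `(F g)·0 = (F h)·0` then `h g⁻¹ ∈ Δ_X̲′` (the label is the
`a`-exponent mod `l`, additive on `F(Δ_X′) = Π_X`, with kernel `F⁻¹(Π_X̲) = Δ_X̲′`). ([IUTchI] §1 p.37)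
[claim: Mochizuki2012, status: disputed] -/
theorem mem_deltaXbar_of_label_eq (hl : D'.l = l) {g h : ↥(D'.PiX ⊓ D'.DeltaC)}
    (he : ArrowModel.cuspAct l (toDih l (F g).right) 0 = ArrowModel.cuspAct l (toDih l (F h).right) 0) :
    ((h * g⁻¹ : ↥(D'.PiX ⊓ D'.DeltaC)) : D'.PiC) ∈ D'.DeltaXbar := by
  rw [cuspAct_toDih_zero l hfree F hF h0 h1, cuspAct_toDih_zero l hfree F hF h0 h1] at he
  have hmem : h * g⁻¹ ∈ (PiXm l ⊓ PiCbarm l).comap F := by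
    rw [Subgroup.mem_comap, ← toZMod_right_left_eq_zero_iff l hfree F hF h0 h1, map_mul, map_inv,
      right_left_mul l (shadow_mem_PiXm l hfree F hF h0 h1 h), toAdd_mul, map_add, ← he]
    have hinv := right_left_mul l (shadow_mem_PiXm l hfree F hF h0 h1 g) (F g)⁻¹
    rw [mul_inv_cancel, SemidirectProduct.one_right, SemidirectProduct.one_left] at hinv
    have hneg : PadicInt.toZMod (Multiplicative.toAdd (F g)⁻¹.right.left) =
        -PadicInt.toZMod (Multiplicative.toAdd (F g).right.left) := by
      rw [eq_neg_iff_add_eq_zero, add_comm, ← map_add, ← toAdd_mul, ← hinv, toAdd_one, map_zero]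
    rw [hneg, add_neg_cancel]
  rw [comap_PiXbar_eq l hfree F hF h0 h1 hb C hX hl, Subgroup.mem_subgroupOf] at hmem
  exact hmem

include hfree hF h0 h1 hb C hX in
/-- **Label injectivity from (I)**: if the cusp inertia groups are `I′_x = ⟨g_x [a,b] g_x⁻¹⟩⁻` and distinct cusps have
non-`Π_X̲`-conjugate inertia, then `x ↦ (F g_x)·0` is injective (`g_y g_x⁻¹ ∈ Δ_X̲′ ⊆ Π_X̲` conjugates `I′_x` onto
`I′_y`). ([IUTchI] §1 p.37) [claim: Mochizuki2012, status: disputed] -/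
theorem eq_of_label_eq (hl : D'.l = l)
    (hI : ∀ (x y : D'.Cusp) (t : D'.PiC), t ∈ D'.PiXbar → MulAut.conj t • D'.inertia x = D'.inertia y → x = y)
    {g : D'.Cusp → D'.PiC} (hg : ∀ x, g x ∈ D'.PiX ⊓ D'.DeltaC)
    (hIg : ∀ x, D'.inertia x = (Subgroup.zpowers (g x * ((gens 0 : D'.PiC) * (gens 1 : D'.PiC) *
      (gens 0 : D'.PiC)⁻¹ * (gens 1 : D'.PiC)⁻¹) * (g x)⁻¹)).topologicalClosure)
    {x y : D'.Cusp} (he : ArrowModel.cuspAct l (toDih l (F ⟨g x, hg x⟩).right) 0 =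
      ArrowModel.cuspAct l (toDih l (F ⟨g y, hg y⟩).right) 0) : x = y := by
  have hn := mem_deltaXbar_of_label_eq l hfree F hF h0 h1 hb C hX hl he
  refine hI x y (g y * (g x)⁻¹) ((inf_le_left : D'.DeltaXbar ≤ D'.PiXbar) hn) ?_
  rw [hIg x, hIg y, conj_smul_topologicalClosure_zpowers]
  congr 2
  group

/-! ### The image of `Ker(Δ_X̲′ ↠ Δ_ε)` -/

include hfree hF h0 h1 hb C hX in
/-- **`F(Ker(Δ_X̲′ ↠ Δ_ε)) = Ker · ∏_{x ≠ ε⁰, ε′, ε″} D_{κ x}`.** ([IUTchI] §1 p.37) [claim: Mochizuki2012, status: disputed] -/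
theorem map_deltaEpsKer_eq (h5 : 5 ≤ l) (hl : D'.l = l) {κ : D'.Cusp → ZMod l}
    (hκ : ∀ x, ((D'.inertia x).subgroupOf (D'.PiX ⊓ D'.DeltaC)).map F = Dm l (κ x)) :
    (D'.deltaEpsKer.subgroupOf (D'.PiX ⊓ D'.DeltaC)).map F =
      (datum l h5).modLKer ⊔ ⨆ t : {x : D'.Cusp // D'.IsNonzeroCusp x ∧ x ≠ D'.ε1 ∧ x ≠ D'.ε2}, Dm l (κ t.1) := by
  have hIle : ∀ x, D'.inertia x ≤ D'.PiX ⊓ D'.DeltaC := fun x => (D'.inertia_le_deltaXbar x).trans deltaXbar_le_deltaX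
  rw [deltaEpsKer, subgroupOf_sup_of_le (B := ⨆ t : {x : D'.Cusp // D'.IsNonzeroCusp x ∧ x ≠ D'.ε1 ∧ x ≠ D'.ε2},
      D'.inertia t.1) (D'.modLKer_le_deltaXbar.trans deltaXbar_le_deltaX) (iSup_le fun t => hIle t.1),
    subgroupOf_iSup_of_le (A := fun t : {x : D'.Cusp // D'.IsNonzeroCusp x ∧ x ≠ D'.ε1 ∧ x ≠ D'.ε2} => D'.inertia t.1)
      (fun t => hIle t.1), Subgroup.map_sup, Subgroup.map_iSup, map_modLKer_eq l hfree F hF h0 h1 hb C hX h5 hl]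
  simp_rw [hκ]

/-! ### (L2c) and (L2a) for a standard shadow -/

include hfree hF h0 h1 hb C hX in
/-- **(L2c) «`0 → I_ε′ × I_ε″ → Δ_ε`» read off the shadow**: with injective labels, `F` carries
`I′_ε′ ∩ (I′_ε″ · Ker(↠ Δ_ε))` into `D_{κ ε′} ∩ (Ker · D_{κ ε″} · ∏_{x ≠ ε⁰,ε′,ε″} D_{κ x}) ⊆ Ker` (part 12, free label
`κ ε⁰`), and `F⁻¹(Ker) ∩ Δ_X̲′ = Ker′ ⊆ Ker(↠ Δ_ε)` (part 13). ([IUTchI] §1 p.37) [claim: Mochizuki2012, status: disputed] -/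
theorem inertia_images_inf_le_of_shadow (h5 : 5 ≤ l) (hl : D'.l = l) {κ : D'.Cusp → ZMod l}
    (hκ : ∀ x, ((D'.inertia x).subgroupOf (D'.PiX ⊓ D'.DeltaC)).map F = Dm l (κ x)) (hinj : Function.Injective κ) :
    D'.inertia D'.ε1 ⊓ (D'.inertia D'.ε2 ⊔ D'.deltaEpsKer) ≤ D'.deltaEpsKer := by
  classical
  have hIle : ∀ x, D'.inertia x ≤ D'.PiX ⊓ D'.DeltaC := fun x => (D'.inertia_le_deltaXbar x).trans deltaXbar_le_deltaX
  rintro z ⟨hz1, hz2⟩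
  have hzX : z ∈ D'.DeltaXbar := D'.inertia_le_deltaXbar _ hz1
  set zh : ↥(D'.PiX ⊓ D'.DeltaC) := ⟨z, deltaXbar_le_deltaX hzX⟩ with hzh
  have hF1 : F zh ∈ Dm l (κ D'.ε1) := by
    rw [← hκ]; exact ⟨zh, hz1, rfl⟩
  have hF2 : F zh ∈ Dm l (κ D'.ε2) ⊔ ((datum l h5).modLKer ⊔
      ⨆ t : {x : D'.Cusp // D'.IsNonzeroCusp x ∧ x ≠ D'.ε1 ∧ x ≠ D'.ε2}, Dm l (κ t.1)) := by
    have hmem : zh ∈ (D'.inertia D'.ε2 ⊔ D'.deltaEpsKer).subgroupOf (D'.PiX ⊓ D'.DeltaC) := hz2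
    rw [subgroupOf_sup_of_le (hIle _) (D'.deltaEpsKer_le_deltaXbar.trans deltaXbar_le_deltaX)] at hmem
    have h := Subgroup.mem_map_of_mem F hmem
    rwa [Subgroup.map_sup, hκ, map_deltaEpsKer_eq l hfree F hF h0 h1 hb C hX h5 hl hκ] at h
  have hkm : κ D'.ε1 ≠ κ D'.ε0 := fun h => D'.ε1_ne_ε0 (hinj h)
  have h21 : κ D'.ε2 ≠ κ D'.ε1 := fun h => D'.ε1_ne_ε2 (hinj h).symm
  have h20 : κ D'.ε2 ≠ κ D'.ε0 := fun h => D'.ε2_ne_ε0 (hinj h)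
  have hFΦ : F zh ∈ (datum l h5).modLKer :=
    line_inf_line_sup_le_modLKer l h5 (fun t : {x : D'.Cusp // D'.IsNonzeroCusp x ∧ x ≠ D'.ε1 ∧ x ≠ D'.ε2} => κ t.1)
      hkm h21 h20 (fun t h => t.2.2.1 (hinj h)) (fun t h => t.2.1 (hinj h)) ⟨hF1, hF2⟩
  have hmem : zh ∈ ((datum l h5).modLKer).comap F ⊓ D'.DeltaXbar.subgroupOf (D'.PiX ⊓ D'.DeltaC) :=
    Subgroup.mem_inf.mpr ⟨hFΦ, hzX⟩
  rw [comap_modLKer_inf_eq l hfree F hF h0 h1 hb C hX h5 hl, Subgroup.mem_subgroupOf] at hmem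
  exact le_sup_left (α := Subgroup D'.PiC) hmem

include hfree hF h0 h1 hb C hX in
/-- **(L2a) «`I_ε′ ≅ ℤ/lℤ` in `Δ_ε`» read off the shadow**: `[I′_ε′ · Ker(↠ Δ_ε) : Ker(↠ Δ_ε)] =
[D_{κ ε′} · E : E] = l` for `E = Ker · ∏_{x ≠ ε⁰,ε′,ε″} D_{κ x}` (part 13's index transfer + part 12, free label `κ ε″`).
([IUTchI] §1 p.37) [claim: Mochizuki2012, status: disputed] -/
theorem inertia_ε1_image_order_of_shadow (h5 : 5 ≤ l) (hl : D'.l = l) {κ : D'.Cusp → ZMod l}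
    (hκ : ∀ x, ((D'.inertia x).subgroupOf (D'.PiX ⊓ D'.DeltaC)).map F = Dm l (κ x)) (hinj : Function.Injective κ) :
    D'.deltaEpsKer.relIndex (D'.inertia D'.ε1 ⊔ D'.deltaEpsKer) = D'.l := by
  classical
  have hIle : ∀ x, D'.inertia x ≤ D'.PiX ⊓ D'.DeltaC := fun x => (D'.inertia_le_deltaXbar x).trans deltaXbar_le_deltaX
  rw [relIndex_eq_relIndex_map l hfree F hF h0 h1 hb C hX h5 hl (A := D'.deltaEpsKer)
    (B := D'.inertia D'.ε1 ⊔ D'.deltaEpsKer) le_sup_left le_sup_right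
    (sup_le (D'.inertia_le_deltaXbar _) D'.deltaEpsKer_le_deltaXbar),
    subgroupOf_sup_of_le (hIle _) (D'.deltaEpsKer_le_deltaXbar.trans deltaXbar_le_deltaX), Subgroup.map_sup, hκ,
    map_deltaEpsKer_eq l hfree F hF h0 h1 hb C hX h5 hl hκ, hl]
  have hkm : κ D'.ε1 ≠ κ D'.ε2 := fun h => D'.ε1_ne_ε2 (hinj h)
  exact relIndex_line_sup l h5 (fun t : {x : D'.Cusp // D'.IsNonzeroCusp x ∧ x ≠ D'.ε1 ∧ x ≠ D'.ε2} => κ t.1) hkm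
    (fun t h => t.2.2.1 (hinj h)) (fun t h => t.2.2.2 (hinj h))

/-! ### NV: the law (I) at the pro-`l` datum -/

/-- **(I) holds at the pro-`l` datum** (consistency of (I) with `CuspGalois` + `ModLCuspLaws` + … of parts 3–8): `Π_X̲` is
abelian there, so `Π_X̲`-conjugation fixes every inertia line `D_x`, and distinct cusps have distinct lines.
([IUTchI] §1 p.37) [claim: Mochizuki2012, status: disputed] -/
theorem inertia_conj_injective_datum (h5 : 5 ≤ l) :
    ∀ (x y : (datum l h5).Cusp) (t : P l), t ∈ (datum l h5).PiXbar →
      MulAut.conj t • (datum l h5).inertia x = (datum l h5).inertia y → x = y := by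
  intro x y t ht hxy
  have ht' : t ∈ PiXm l ⊓ PiCbarm l := ht
  rw [inertia_eq, inertia_eq, conj_smul_Dm, toDih_right_of_mem_PiXbar l ht'.1 ht'.2, DihedralGroup.one_def,
    ArrowModel.cuspAct_r, add_zero] at hxy
  exact Dm_injective l h5 hxy

end ProLModel

/-! ### (L2a), (L2c) at a genuine `GeomOrigin` datum -/

namespace GeomOrigin

open Literature.AnabelianGeometry.AbsoluteAnabelian ProLModel
open scoped Pointwise

variable {D : PuncturedEllipticData.{u}}

/-- The standard shadow data of a `GeomOrigin` datum with (I): a standard free basis, a shadow `F`, and INJECTIVE labels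
`κ` with `F(I_x) = D_{κ x}`. ([IUTchI] §1 p.37) [claim: Mochizuki2012, status: disputed] -/
theorem exists_shadow_labels (O : D.GeomOrigin) (C : D.CuspGalois) (hl : D.l.Prime)
    (hX : D.PiXbar.relIndex D.PiX = D.l)
    (hI : ∀ (x y : D.Cusp) (t : D.PiC), t ∈ D.PiXbar → MulAut.conj t • D.inertia x = D.inertia y → x = y) :
    haveI : Fact D.l.Prime := ⟨hl⟩
    ∃ (gens : Fin 2 → ↥(D.PiX ⊓ D.DeltaC)) (F : ↥(D.PiX ⊓ D.DeltaC) →* P D.l) (κ : D.Cusp → ZMod D.l),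
      IsFreeProOn ↥(D.PiX ⊓ D.DeltaC) Set.univ gens ∧ Continuous F ∧ F (gens 0) = elA D.l 1 ∧
        F (gens 1) = inN D.l (δ D.l 0) ∧ (gens 1 : D.PiC) ∈ D.PiCbar ∧
        (∀ x, ((D.inertia x).subgroupOf (D.PiX ⊓ D.DeltaC)).map F = Dm D.l (κ x)) ∧ Function.Injective κ := by
  haveI : Fact D.l.Prime := ⟨hl⟩
  obtain ⟨gens, hfree, hb, hcusp⟩ := O.exists_standard_gens C hl hX
  obtain ⟨F, hF, h0, h1⟩ := exists_shadowHom D.l D hfree (elA D.l 1) (inN D.l (δ D.l 0))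
  choose g hg hIg using hcusp
  refine ⟨gens, F, fun x => ArrowModel.cuspAct D.l (toDih D.l (F ⟨g x, hg x⟩).right) 0, hfree, hF, h0, h1, hb,
    fun x => map_inertia_eq D.l F hF h0 h1 (hg x) (hIg x), fun x y he => ?_⟩
  exact eq_of_label_eq D.l hfree F hF h0 h1 hb C hX rfl hI hg hIg he

/-- **(L2c) at a genuine datum — «a natural exact sequence `0 → I_ε′ × I_ε″ → Δ_ε`» (p. 37 l. 34)**, abc-iut-L5-t1's
field `ModLCuspLaws.inertia_images_inf_le` / the binder `hL2c` of the Cor. 1.2 closers, DERIVED from the origin record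
(A) (c′), a cusp action, `[Π_X : Π_X̲] = l` prime and (I) «distinct cusps have non-`Π_X̲`-conjugate inertia».
([IUTchI] §1 p.37) [claim: Mochizuki2012, status: disputed] -/
theorem inertia_images_inf_le (O : D.GeomOrigin) (C : D.CuspGalois) (hl : D.l.Prime)
    (hX : D.PiXbar.relIndex D.PiX = D.l)
    (hI : ∀ (x y : D.Cusp) (t : D.PiC), t ∈ D.PiXbar → MulAut.conj t • D.inertia x = D.inertia y → x = y) :
    D.inertia D.ε1 ⊓ (D.inertia D.ε2 ⊔ D.deltaEpsKer) ≤ D.deltaEpsKer := by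
  haveI : Fact D.l.Prime := ⟨hl⟩
  obtain ⟨gens, F, κ, hfree, hF, h0, h1, hb, hκ, hinj⟩ := O.exists_shadow_labels C hl hX hI
  exact inertia_images_inf_le_of_shadow D.l hfree F hF h0 h1 hb C hX D.five_le rfl hκ hinj

/-- **(L2a) at a genuine datum — «noncanonical isomorphisms `I_ε′ ≅ ℤ/lℤ`» in `Δ_ε` (p. 37 l. 36)**, abc-iut-L5-t1's field
`ModLCuspLaws.inertia_ε1_image_order` / the binder `hL2a` of the Cor. 1.2 closers, DERIVED from (A) (c′), a cusp action,
`[Π_X : Π_X̲] = l` prime and (I). ([IUTchI] §1 p.37) [claim: Mochizuki2012, status: disputed] -/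
theorem inertia_ε1_image_order (O : D.GeomOrigin) (C : D.CuspGalois) (hl : D.l.Prime)
    (hX : D.PiXbar.relIndex D.PiX = D.l)
    (hI : ∀ (x y : D.Cusp) (t : D.PiC), t ∈ D.PiXbar → MulAut.conj t • D.inertia x = D.inertia y → x = y) :
    D.deltaEpsKer.relIndex (D.inertia D.ε1 ⊔ D.deltaEpsKer) = D.l := by
  haveI : Fact D.l.Prime := ⟨hl⟩
  obtain ⟨gens, F, κ, hfree, hF, h0, h1, hb, hκ, hinj⟩ := O.exists_shadow_labels C hl hX hI
  exact inertia_ε1_image_order_of_shadow D.l hfree F hF h0 h1 hb C hX D.five_le rfl hκ hinj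

end GeomOrigin

end PuncturedEllipticData

end Literature.IUT.HodgeTheaters
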